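import Summits.NavierStokesRegularity.NavierStokesRegularity.Theses.HardyPointSink
import Literature.Analysis.FluidPDE.KNSSMildGradientBound
import Literature.Analysis.FluidPDE.BoundedMildSmoothRemainder
import Summits.NavierStokesRegularity.NavierStokesRegularity.Theorems.HardyPointSinkNoHardyTypeIAncientWeakL3Liouville

/-!
# Route HardyPointSink — crux `NoHardyTypeIAncient` (stmt-NavierStokesRegularity-7980), line `birth`:
# certificate — a gap for the Hardy constant

Summit-side proof file (certificate sub-goal `hardyPointSink_cert_smallHardy` of the registered
skeleton `Cruxes/NoHardyTypeIAncient/Lines/birth.lean`, lead c4). There is a universal `K₀ > 0`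
such that every bounded ancient mild solution of Navier–Stokes (`ν = 1`, duality form) with
measurable slices, jointly a.e.-strongly measurable on `(−∞, 0) × ℝ³`, and Hardy-bounded about
every centre at a.e. time with a constant `K < K₀` (`∫ |u(t)|²/|x − x₀| ≤ K`), vanishes a.e. on
a.e. slice. Everything is scale-free:

* the continuous bounded ancient Oseen-mild representative `U` of `u` (`stub_hardyOseenWindow`,
  `stub_oseenAncientGluing`) carries the Hardy bound on EVERY slice
  (`hardyPointSink_hardyEverySlice`);
* if `U ≢ 0`, put `N := sup |U| > 0` and pick `(t₀, x₀)` with `|U(t₀, x₀)| > N/2`; on the window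
  `[t₀ − 2N⁻², t₀/2]`, translated to start at time `0` (`oseenDuhamel_translate`) and clamped
  (`isKNSSDriftMild_clamp_of_oseenForward`), KNSS's quantitative smoothing (4.6)
  (`IsKNSSDriftMild.exists_gradient_bound`, lag `t − s = N⁻²`) gives `|∇U(t₀)| ≤ C N²` with a
  universal `C`;
* by the mean value inequality `|U(t₀)| ≥ N/4` on `B(x₀, ρ)`, `ρ = 1/(4(C+1)N)`, so
  `K ≥ ∫_{B(x₀,ρ)} |U(t₀)|²/|x − x₀| ≥ (N/4)² ρ² |B₁| = |B₁|/(256 (C+1)²) =: K₀`.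

## References

* H. Koch, N. Nadirashvili, G. Seregin, V. Šverák, *Liouville theorems for the Navier–Stokes
  equations and applications*, Acta Math. 203 (2009) 83–105 = arXiv:0709.3599, §4 Prop. 4.1,
  (4.6).
-/

noncomputable section

set_option linter.dupNamespace false

open MeasureTheory Set Function Filter TopologicalSpace Metric
open scoped ENNReal NNReal Topology

namespace Summit.NavierStokesRegularity.NavierStokesRegularity.Theorems

/-- **KNSS (4.6) on a backward window of an ancient Oseen-mild field, scale-free form.** If `U` is
a continuous ancient Oseen-mild field on `(−∞, 0) × ℝ³` with `|U| ≤ N`, `N > 0`, and `C` is the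
universal constant of `IsKNSSDriftMild.exists_gradient_bound`, then every slice `U(t₀)`, `t₀ < 0`,
is differentiable with `|∇U(t₀)| ≤ C N²` (translate the window `[t₀ − 2N⁻², t₀/2]` to start at
`0`, clamp, and apply (4.6) with lag `N⁻²`).
[cite: KochNadirashviliSereginSverak2009, §4 Prop. 4.1, (4.6) (arXiv:0709.3599 p. 8)] -/
theorem hardyPointSink_smallHardy_gradient {C : ℝ}
    (hC : ∀ ⦃T N : ℝ⦄ ⦃V : ℝ → EuclideanSpace ℝ (Fin 3) → EuclideanSpace ℝ (Fin 3)⦄,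
      Literature.Analysis.FluidPDE.IsKNSSDriftMild T N V 0 →
      ∀ ⦃s t : ℝ⦄, 0 < s → s < t → t < T → N ^ 2 * (t - s) ≤ 1 →
        ∀ x, (t - s) ^ (1 / 2 : ℝ) * ‖fderiv ℝ (V t) x‖ ≤ C * N)
    (U : ℝ → EuclideanSpace ℝ (Fin 3) → EuclideanSpace ℝ (Fin 3))
    (hUcont : ContinuousOn (uncurry U) (Iio (0 : ℝ) ×ˢ (univ : Set (EuclideanSpace ℝ (Fin 3)))))
    {N : ℝ} (hN : 0 < N) (hUN : ∀ t < 0, ∀ x, ‖U t x‖ ≤ N)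
    (hUdiv : ∀ t < 0, Literature.Analysis.FluidPDE.IsWeaklyDivFree (U t))
    (hUmild : ∀ s t : ℝ, s < t → t < 0 → ∀ x,
      U t x = Literature.Analysis.UnboundedOperators.heatExtension (U s) (t - s) x -
        Literature.Analysis.FluidPDE.oseenDuhamel 1 s U U t x)
    {t₀ : ℝ} (ht₀ : t₀ < 0) :
    (∀ x, DifferentiableAt ℝ (U t₀) x) ∧ ∀ x, ‖fderiv ℝ (U t₀) x‖ ≤ C * N ^ 2 := by
  have hE : Module.finrank ℝ (EuclideanSpace ℝ (Fin 3)) = 3 := by simp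
  -- the lag `h = N⁻²`, the origin `a` and the length `S` of the translated window
  obtain ⟨h, hh⟩ : ∃ h : ℝ, h = (1 / N) ^ 2 := ⟨_, rfl⟩
  have hhpos : 0 < h := by rw [hh]; positivity
  obtain ⟨a, ha⟩ : ∃ a : ℝ, a = t₀ - 2 * h := ⟨_, rfl⟩
  obtain ⟨S, hS⟩ : ∃ S : ℝ, S = 2 * h - t₀ / 2 := ⟨_, rfl⟩
  have hSpos : 0 < S := by linarith
  have h2hS : 2 * h < S := by linarith
  have haS : ∀ τ : ℝ, τ ≤ S → τ + a < 0 := fun τ hτ => by linarith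
  have h2ha : 2 * h + a = t₀ := by linarith
  -- the translated field `τ ↦ U (τ + a)` on `[0, S]`
  have hWcont : ContinuousOn (uncurry fun τ => U (τ + a))
      (Icc (0 : ℝ) S ×ˢ (univ : Set (EuclideanSpace ℝ (Fin 3)))) := by
    have hmap : Continuous fun p : ℝ × EuclideanSpace ℝ (Fin 3) => (p.1 + a, p.2) := by fun_prop
    refine (hUcont.comp hmap.continuousOn ?_).congr fun p _ => rfl
    intro p hp
    exact ⟨haS p.1 hp.1.2, mem_univ _⟩
  have hWbd : ∀ τ ∈ Icc (0 : ℝ) S, ∀ x, ‖U (τ + a) x‖ ≤ N := fun τ hτ x => hUN _ (haS τ hτ.2) x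
  have hWdiv : ∀ τ ∈ Icc (0 : ℝ) S, Literature.Analysis.FluidPDE.IsWeaklyDivFree (U (τ + a)) :=
    fun τ hτ => hUdiv _ (haS τ hτ.2)
  have hWmild : ∀ s t : ℝ, 0 ≤ s → s < t → t ≤ S → ∀ x,
      U (t + a) x = Literature.Analysis.UnboundedOperators.heatExtension (U (s + a)) (t - s) x -
        Literature.Analysis.FluidPDE.oseenDuhamel 1 s (fun τ => U (τ + a)) (fun τ => U (τ + a))
          t x := by
    intro s t _ hst htS x
    have h1 := hUmild (s + a) (t + a) (by linarith) (haS t htS) x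
    rw [Literature.Analysis.FluidPDE.oseenDuhamel_translate 1 s a U U t x, h1,
      add_sub_add_right_eq_sub]
  have hV : Literature.Analysis.FluidPDE.IsKNSSDriftMild S N
      (fun t x => U (max 0 (min t S) + a) x) 0 :=
    Literature.Analysis.FluidPDE.isKNSSDriftMild_clamp_of_oseenForward (u := fun τ => U (τ + a))
      hSpos hWcont hWbd hWdiv hWmild
  -- time bookkeeping: local time `2h` is `t₀`
  have hclamp : max 0 (min (2 * h) S) = 2 * h := by
    rw [min_eq_left h2hS.le, max_eq_right (by positivity)]
  have hfun : (fun x => U (max 0 (min (2 * h) S) + a) x) = U t₀ := by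
    funext x
    rw [hclamp, h2ha]
  have hN2h : N ^ 2 * (2 * h - h) ≤ 1 := by
    have : N ^ 2 * h = 1 := by
      rw [hh]
      field_simp
    linarith
  -- KNSS (4.6) with lag `h`
  have hgrad : ∀ x, (2 * h - h) ^ (1 / 2 : ℝ) *
      ‖fderiv ℝ (fun x => U (max 0 (min (2 * h) S) + a) x) x‖ ≤ C * N :=
    hC hV hhpos (show h < 2 * h by linarith) h2hS hN2h
  rw [hfun, show (2 : ℝ) * h - h = h by ring, hh, ← Real.sqrt_eq_rpow,
    Real.sqrt_sq (by positivity)] at hgrad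
  refine ⟨fun x => ?_, fun x => ?_⟩
  · have hd : DifferentiableAt ℝ (fun x => U (max 0 (min (2 * h) S) + a) x) x :=
      (Literature.Analysis.FluidPDE.IsKNSSDriftMild.hasFDerivAt_slice hE hV one_half_pos
        one_half_lt_one hhpos (show h < 2 * h by linarith) h2hS x).differentiableAt
    rwa [hfun] at hd
  · have h1 := hgrad x
    rw [one_div, inv_mul_le_iff₀ hN] at h1
    calc ‖fderiv ℝ (U t₀) x‖ ≤ N * (C * N) := h1
      _ = C * N ^ 2 := by ring

/-- **Hardy functional of a field bounded below on a ball.** If `m ≤ |f|` on `B(x₀, ρ)` (`m ≥ 0`,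
`ρ > 0`), then `∫ |f|²/|x − x₀| ≥ (m²/ρ)·|B(x₀, ρ)| = m² ρ² |B₁|`. [folklore] -/
theorem hardyPointSink_smallHardy_ballLower
    (f : EuclideanSpace ℝ (Fin 3) → EuclideanSpace ℝ (Fin 3)) (x₀ : EuclideanSpace ℝ (Fin 3))
    {m ρ : ℝ} (hm : 0 ≤ m) (hρ : 0 < ρ) (hf : ∀ y ∈ ball x₀ ρ, m ≤ ‖f y‖) :
    ENNReal.ofReal (m ^ 2 * ρ ^ 2) * volume (ball (0 : EuclideanSpace ℝ (Fin 3)) 1) ≤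
      ∫⁻ x, ‖f x‖ₑ ^ 2 / ‖x - x₀‖ₑ := by
  calc ENNReal.ofReal (m ^ 2 * ρ ^ 2) * volume (ball (0 : EuclideanSpace ℝ (Fin 3)) 1)
      = ENNReal.ofReal (m ^ 2 / ρ) * volume (ball x₀ ρ) := by
        rw [Measure.addHaar_ball volume x₀ hρ.le, finrank_euclideanSpace_fin, ← mul_assoc,
          ← ENNReal.ofReal_mul (by positivity)]
        congr 2
        field_simp
    _ = ∫⁻ _ in ball x₀ ρ, ENNReal.ofReal (m ^ 2 / ρ) := (setLIntegral_const _ _).symm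
    _ ≤ ∫⁻ x in ball x₀ ρ, ‖f x‖ₑ ^ 2 / ‖x - x₀‖ₑ := by
        refine setLIntegral_mono' measurableSet_ball fun x hx => ?_
        rw [ENNReal.ofReal_div_of_pos hρ, ENNReal.ofReal_pow hm]
        have hx' : ‖x - x₀‖ < ρ := by rwa [mem_ball, dist_eq_norm] at hx
        refine ENNReal.div_le_div ?_ ?_
        · gcongr
          rw [← ofReal_norm]
          exact ENNReal.ofReal_le_ofReal (hf x hx)
        · rw [← ofReal_norm]
          exact ENNReal.ofReal_le_ofReal hx'.le
    _ ≤ ∫⁻ x, ‖f x‖ₑ ^ 2 / ‖x - x₀‖ₑ := setLIntegral_le_lintegral _ _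

/-- **Certificate `hardyPointSink_cert_smallHardy` (a gap for the Hardy constant).** There is
a universal `K₀ > 0` such that every bounded ancient mild solution (duality form, `ν = 1`) with
measurable slices, jointly a.e.-strongly measurable on the slab, Hardy-bounded about every centre
at a.e. time with constant `K < K₀`, vanishes a.e. on a.e. slice: for the continuous Oseen
representative `U` (`stub_hardyOseenWindow`, `stub_oseenAncientGluing`, Hardy on EVERY slice) with
`N = sup |U| > 0`, KNSS's quantitative smoothing (`IsKNSSDriftMild.exists_gradient_bound` via
`isKNSSDriftMild_clamp_of_oseenForward`, lag `N⁻²`) gives `|∇U| ≤ C N²`, so `|U(t₀, ·)| ≥ N/4`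
on `B(x₀, 1/(4 (C+1) N))` about a point where `|U(t₀, x₀)| > N/2`, whence
`∫ |U(t₀)|²/|x − x₀| ≥ |B₁|/(256 (C+1)²) =: K₀` — scale-free. No Type-I bound is used.
[cite: KochNadirashviliSereginSverak2009, §4 Prop. 4.1, (4.6) (arXiv:0709.3599 p. 8)] -/
theorem hardyPointSink_cert_smallHardy :
    ∃ K₀ : ℝ≥0, 0 < K₀ ∧
    ∀ (u : ℝ → EuclideanSpace ℝ (Fin 3) → EuclideanSpace ℝ (Fin 3)) (K : ℝ≥0), K < K₀ →
      (∀ t < 0, AEStronglyMeasurable (u t) volume) →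
      AEStronglyMeasurable (uncurry u)
        (volume.restrict (Iio (0 : ℝ) ×ˢ (univ : Set (EuclideanSpace ℝ (Fin 3))))) →
      Literature.Analysis.FluidPDE.IsBoundedAncientMildSolution 1 u →
      (∀ x₀ : EuclideanSpace ℝ (Fin 3), ∀ᵐ t ∂(volume.restrict (Iio (0 : ℝ))),
        ∫⁻ x, ‖u t x‖ₑ ^ 2 / ‖x - x₀‖ₑ ≤ K) →
      ∀ᵐ t ∂(volume.restrict (Iio (0 : ℝ))), u t =ᵐ[volume] 0 := by
  have hE : Module.finrank ℝ (EuclideanSpace ℝ (Fin 3)) = 3 := by simp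
  obtain ⟨C, hC0, hC⟩ :=
    Literature.Analysis.FluidPDE.IsKNSSDriftMild.exists_gradient_bound
      (E := EuclideanSpace ℝ (Fin 3)) hE
  -- the universal constant `K₀ = |B₁| / (256 (C+1)²)`
  obtain ⟨c₀, hc₀⟩ : ∃ c₀ : ℝ, c₀ = 1 / (256 * (C + 1) ^ 2) := ⟨_, rfl⟩
  have hc₀pos : 0 < c₀ := by rw [hc₀]; positivity
  have hBpos : 0 < volume (ball (0 : EuclideanSpace ℝ (Fin 3)) 1) := measure_ball_pos volume 0 one_pos
  have hBtop : volume (ball (0 : EuclideanSpace ℝ (Fin 3)) 1) < ⊤ := measure_ball_lt_top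
  have hK₀top : ENNReal.ofReal c₀ * volume (ball (0 : EuclideanSpace ℝ (Fin 3)) 1) ≠ ⊤ :=
    ENNReal.mul_ne_top ENNReal.ofReal_ne_top hBtop.ne
  have hK₀pos : ENNReal.ofReal c₀ * volume (ball (0 : EuclideanSpace ℝ (Fin 3)) 1) ≠ 0 :=
    mul_ne_zero (ENNReal.ofReal_pos.2 hc₀pos).ne' hBpos.ne'
  refine ⟨(ENNReal.ofReal c₀ * volume (ball (0 : EuclideanSpace ℝ (Fin 3)) 1)).toNNReal,
    ENNReal.toNNReal_pos hK₀pos hK₀top, ?_⟩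
  intro u K hKK₀ hmeas hjoint hu hK
  have hKlt : (K : ℝ≥0∞) < ENNReal.ofReal c₀ * volume (ball (0 : EuclideanSpace ℝ (Fin 3)) 1) := by
    have h := ENNReal.coe_lt_coe.2 hKK₀
    rwa [ENNReal.coe_toNNReal hK₀top] at h
  -- the ancient Oseen-mild representative
  obtain ⟨U, hUcont, ⟨CU, hUC⟩, hUdiv, hUmild, hUae, -⟩ :=
    stub_oseenAncientGluing u hmeas hu
      (stub_hardyOseenWindow stub_hardyDriftConstant u hmeas hjoint hu ⟨K, hK⟩)
  -- Hardy bound on every slice of `U`, every centre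
  have hHU : ∀ t < 0, ∀ x₀ : EuclideanSpace ℝ (Fin 3), ∫⁻ x, ‖U t x‖ₑ ^ 2 / ‖x - x₀‖ₑ ≤ K :=
    hardyPointSink_hardyEverySlice u U K hUcont hUae hK
  -- `U ≡ 0` on the open slab
  have hU0 : ∀ t < 0, ∀ x, U t x = 0 := by
    by_contra hne
    push Not at hne
    obtain ⟨t₁, ht₁, x₁, hx₁⟩ := hne
    -- `N = sup |U| > 0`
    have hbdd : BddAbove ((fun p : ℝ × EuclideanSpace ℝ (Fin 3) => ‖U p.1 p.2‖) ''
        (Iio (0 : ℝ) ×ˢ (univ : Set (EuclideanSpace ℝ (Fin 3))))) := by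
      refine ⟨CU, ?_⟩
      rintro _ ⟨p, hp, rfl⟩
      exact hUC p.1 hp.1 p.2
    obtain ⟨N, hN⟩ : ∃ N : ℝ, N = sSup ((fun p : ℝ × EuclideanSpace ℝ (Fin 3) => ‖U p.1 p.2‖) ''
        (Iio (0 : ℝ) ×ˢ (univ : Set (EuclideanSpace ℝ (Fin 3))))) := ⟨_, rfl⟩
    have hmemS : ∀ t < 0, ∀ x, ‖U t x‖ ∈ (fun p : ℝ × EuclideanSpace ℝ (Fin 3) => ‖U p.1 p.2‖) ''
        (Iio (0 : ℝ) ×ˢ (univ : Set (EuclideanSpace ℝ (Fin 3)))) :=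
      fun t ht x => ⟨(t, x), ⟨ht, mem_univ _⟩, rfl⟩
    have hleN : ∀ t < 0, ∀ x, ‖U t x‖ ≤ N := fun t ht x => by
      rw [hN]; exact le_csSup hbdd (hmemS t ht x)
    have hNpos : 0 < N := (norm_pos_iff.2 hx₁).trans_le (hleN t₁ ht₁ x₁)
    have hlt : N / 2 < sSup ((fun p : ℝ × EuclideanSpace ℝ (Fin 3) => ‖U p.1 p.2‖) ''
        (Iio (0 : ℝ) ×ˢ (univ : Set (EuclideanSpace ℝ (Fin 3))))) := by
      rw [← hN]; exact half_lt_self hNpos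
    obtain ⟨_, ⟨⟨t₀, x₀⟩, ht₀, rfl⟩, hbig⟩ := exists_lt_of_lt_csSup ⟨_, hmemS t₁ ht₁ x₁⟩ hlt
    have ht₀' : t₀ < 0 := ht₀.1
    change N / 2 < ‖U t₀ x₀‖ at hbig
    -- `|∇U(t₀)| ≤ C N²`
    obtain ⟨hdiff, hgrad⟩ :=
      hardyPointSink_smallHardy_gradient hC U hUcont hNpos hleN hUdiv hUmild ht₀'
    -- `|U(t₀)| ≥ N/4` on `B(x₀, ρ)`
    obtain ⟨ρ, hρ⟩ : ∃ ρ : ℝ, ρ = 1 / (4 * (C + 1) * N) := ⟨_, rfl⟩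
    have hρpos : 0 < ρ := by rw [hρ]; positivity
    have hlow : ∀ y ∈ ball x₀ ρ, N / 4 ≤ ‖U t₀ y‖ := by
      intro y hy
      have hmv : ‖U t₀ y - U t₀ x₀‖ ≤ C * N ^ 2 * ‖y - x₀‖ :=
        convex_univ.norm_image_sub_le_of_norm_fderiv_le (fun x _ => hdiff x) (fun x _ => hgrad x)
          (mem_univ x₀) (mem_univ y)
      have hyx : ‖y - x₀‖ < ρ := by rwa [mem_ball, dist_eq_norm] at hy
      have h1 : C * N ^ 2 * ‖y - x₀‖ ≤ C * N ^ 2 * ρ :=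
        mul_le_mul_of_nonneg_left hyx.le (by positivity)
      have h2 : C * N ^ 2 * ρ ≤ N / 4 := by
        have hC1 : 0 < C + 1 := by linarith
        rw [hρ, show C * N ^ 2 * (1 / (4 * (C + 1) * N)) = N / 4 * (C / (C + 1)) by
          field_simp]
        have : C / (C + 1) ≤ 1 := (div_le_one hC1).2 (by linarith)
        calc N / 4 * (C / (C + 1)) ≤ N / 4 * 1 := by gcongr
          _ = N / 4 := mul_one _
      have h3 : ‖U t₀ x₀‖ - ‖U t₀ y - U t₀ x₀‖ ≤ ‖U t₀ y‖ := by
        have := norm_sub_norm_le (U t₀ x₀) (U t₀ y)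
        rw [← norm_neg (U t₀ x₀ - U t₀ y), neg_sub] at this
        linarith
      linarith
    have hball := hardyPointSink_smallHardy_ballLower (U t₀) x₀
      (by positivity : (0 : ℝ) ≤ N / 4) hρpos hlow
    have hconst : (N / 4) ^ 2 * ρ ^ 2 = c₀ := by
      rw [hρ, hc₀]
      field_simp
      ring
    rw [hconst] at hball
    exact absurd ((hball.trans (hHU t₀ ht₀' x₀)).trans_lt hKlt) (lt_irrefl _)
  -- hence `u = 0` a.e. on a.e. slice
  filter_upwards [hUae, ae_restrict_mem measurableSet_Iio] with t ht htneg
  filter_upwards [ht] with x hx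
  rw [hx, hU0 t htneg x]
  rfl

end Summit.NavierStokesRegularity.NavierStokesRegularity.Theorems

end
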